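import Summits.QuantumFields.YangMills.Theorems.ColdStartUniversalityShenZhuZhuRiemannDistSU2
import Literature.MathematicalPhysics.QuantumFieldTheory.LatticeGaugeDobrushinPoincare
import HarnessLib

/-!
# Shen–Zhu–Zhu's Riemannian distance on `SU(2)`: symmetry, invariance, diameter `√2·π`, `ρ = 0 ↔ g = h`, and the CHORD–ARC comparison
# `‖h − g‖_F ≤ ρ(g,h) ≤ (π/2)·‖h − g‖_F` (link by link, and for the torus cost `ρ_L² = Σ_e ρ(U_e,U'_e)²`)

Seat `ym-line-csu-p1` (g41), route `ColdStartUniversality` of `Summits/QuantumFields/YangMills`, helper file G41 (`--supports stmt-QuantumFields-24809`).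
Sequel to G40 (`riemannDist_two_eq`: `ρ(g,h) = √2·arccos(Re tr(h gᴴ)/2)` for `r = fundamentalLatticeRep 2`).  With `c = Re tr(h gᴴ)/2 = cos(ρ/√2)`
and `‖h − g‖_F² = 4(1 − c)`:

* §1 `riemannDist_two_comm`, `riemannDist_two_mul_left/right` (bi-invariance), `riemannDist_two_le` (`ρ ≤ √2·π`), `riemannDist_two_eq_zero_iff`.
* §2 `hsForm_sub_self_two` (`‖h − g‖_F² = 4 − 2 Re tr(h gᴴ)`); ★★ `sqrt_hsForm_sub_le_riemannDist_two` (chord ≤ arc, `1 − θ²/2 ≤ cos θ`);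
  ★★ `riemannDist_two_le_pi_div_two_mul_sqrt_hsForm_sub` (arc ≤ (π/2)·chord, Jordan's inequality `sin x ≥ (2/π)x` at `x = θ/2`); the same two
  bounds in the Literature's `frobNorm` (`frobNorm_sub_le_riemannDist_two`, `riemannDist_two_le_pi_div_two_mul_frobNorm_sub`).
* §3 the torus cost of SZZ (4.5): ★★ `sum_hsForm_sub_le_torusRiemannDistSq_two` / ★★ `torusRiemannDistSq_two_le` —
  `Σ_e ‖U'_e − U_e‖_F² ≤ ρ_L(U,U')² ≤ (π²/4)·Σ_e ‖U'_e − U_e‖_F²` on every torus, every dimension.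

So every Frobenius-Lipschitz / Frobenius-contraction statement of the seat's fixed-cut-off package converts to the Riemannian currency of the named
facts `shenZhuZhu_finiteVolumeErgodicity` / `shenZhuZhu_weightedContraction` at the cost of the universal factor `π/2` (and conversely for free).

THEOREMS ONLY, no definition, no sorry.  HONEST FRAMING: metric geometry of `SU(2)`; the `W₂` contraction (4.5) is NOT proved; nothing `K`-uniform
along the route's scaling (`UniformColdStartMixing`, 24809, ASIDE, not restated); no crux, rung or summit statement is proved; the Yang–Mills mass
gap is NOT proved.

References: H. Shen, R. Zhu, X. Zhu, CMP 400 (2023) 805–851 = arXiv:2204.12737, §4.1, Thm 4.2 (4.5) [ShenZhuZhu2022]; S. Gallot, D. Hulin,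
J. Lafontaine, *Riemannian Geometry* (2004), 2.90–2.91 [GallotHulinLafontaine2004].
-/

set_option autoImplicit false

noncomputable section

namespace Summit.QuantumFields.YangMills.Theorems.ColdStartUniversality

open Matrix Complex Finset
open scoped ComplexConjugate BigOperators Real
open Literature.MathematicalPhysics.QuantumFieldTheory
open Literature.MathematicalPhysics.QuantumLattice (fundamentalRep fundamentalLatticeRep fundamentalRep_apply fundamentalLatticeRep_N)

/-! ## §1. Symmetry, bi-invariance, diameter, non-degeneracy -/

/-- `Re tr(h gᴴ) = Re tr(g hᴴ)`. [folklore] -/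
theorem re_trace_mul_star_comm (g h : Matrix.specialUnitaryGroup (Fin 2) ℂ) :
    (((h : Matrix (Fin 2) (Fin 2) ℂ) * star (g : Matrix (Fin 2) (Fin 2) ℂ)).trace.re) =
      (((g : Matrix (Fin 2) (Fin 2) ℂ) * star (h : Matrix (Fin 2) (Fin 2) ℂ)).trace.re) := by
  have hT : ((g : Matrix (Fin 2) (Fin 2) ℂ) * star (h : Matrix (Fin 2) (Fin 2) ℂ)) =
      ((h : Matrix (Fin 2) (Fin 2) ℂ) * star (g : Matrix (Fin 2) (Fin 2) ℂ))ᴴ := by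
    rw [Matrix.star_eq_conjTranspose, Matrix.star_eq_conjTranspose, Matrix.conjTranspose_mul, Matrix.conjTranspose_conjTranspose]
  rw [hT, Matrix.trace_conjTranspose, Complex.star_def, Complex.conj_re]

/-- ★ **Symmetry**: `ρ(g,h) = ρ(h,g)` on `SU(2)`. [cite: GallotHulinLafontaine2004, 2.91] -/
theorem riemannDist_two_comm (g h : Matrix.specialUnitaryGroup (Fin 2) ℂ) :
    (fundamentalLatticeRep 2).riemannDist g h = (fundamentalLatticeRep 2).riemannDist h g := by
  rw [riemannDist_two_eq, riemannDist_two_eq, re_trace_mul_star_comm]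

/-- ★ **Left invariance**: `ρ(kg, kh) = ρ(g,h)` (the metric is bi-invariant). [cite: ShenZhuZhu2022, §4.1] -/
theorem riemannDist_two_mul_left (k g h : Matrix.specialUnitaryGroup (Fin 2) ℂ) :
    (fundamentalLatticeRep 2).riemannDist (k * g) (k * h) = (fundamentalLatticeRep 2).riemannDist g h := by
  rw [riemannDist_two_eq, riemannDist_two_eq]
  have hk : star (k : Matrix (Fin 2) (Fin 2) ℂ) * (k : Matrix (Fin 2) (Fin 2) ℂ) = 1 := k.prop.1.1
  have e1 : (((k * h : Matrix.specialUnitaryGroup (Fin 2) ℂ) : Matrix (Fin 2) (Fin 2) ℂ) * star ((k * g : Matrix.specialUnitaryGroup (Fin 2) ℂ) :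
      Matrix (Fin 2) (Fin 2) ℂ)).trace = (((h : Matrix (Fin 2) (Fin 2) ℂ) * star (g : Matrix (Fin 2) (Fin 2) ℂ))).trace := by
    change ((k : Matrix (Fin 2) (Fin 2) ℂ) * (h : Matrix (Fin 2) (Fin 2) ℂ) * star ((k : Matrix (Fin 2) (Fin 2) ℂ) * (g : Matrix (Fin 2) (Fin 2) ℂ))).trace = _
    rw [star_mul, show (k : Matrix (Fin 2) (Fin 2) ℂ) * (h : Matrix (Fin 2) (Fin 2) ℂ) * (star (g : Matrix (Fin 2) (Fin 2) ℂ) *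
        star (k : Matrix (Fin 2) (Fin 2) ℂ)) = (k : Matrix (Fin 2) (Fin 2) ℂ) * ((h : Matrix (Fin 2) (Fin 2) ℂ) * star (g : Matrix (Fin 2) (Fin 2) ℂ)) *
        star (k : Matrix (Fin 2) (Fin 2) ℂ) by simp only [Matrix.mul_assoc], Matrix.trace_mul_cycle, hk, Matrix.one_mul]
  rw [e1]

/-- ★ **Right invariance**: `ρ(gk, hk) = ρ(g,h)`. [cite: ShenZhuZhu2022, §4.1] -/
theorem riemannDist_two_mul_right (k g h : Matrix.specialUnitaryGroup (Fin 2) ℂ) :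
    (fundamentalLatticeRep 2).riemannDist (g * k) (h * k) = (fundamentalLatticeRep 2).riemannDist g h := by
  rw [riemannDist_two_eq, riemannDist_two_eq]
  have hk : (k : Matrix (Fin 2) (Fin 2) ℂ) * star (k : Matrix (Fin 2) (Fin 2) ℂ) = 1 := k.prop.1.2
  have e1 : ((h * k : Matrix.specialUnitaryGroup (Fin 2) ℂ) : Matrix (Fin 2) (Fin 2) ℂ) * star ((g * k : Matrix.specialUnitaryGroup (Fin 2) ℂ) :
      Matrix (Fin 2) (Fin 2) ℂ) = (h : Matrix (Fin 2) (Fin 2) ℂ) * star (g : Matrix (Fin 2) (Fin 2) ℂ) := by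
    change (h : Matrix (Fin 2) (Fin 2) ℂ) * (k : Matrix (Fin 2) (Fin 2) ℂ) * star ((g : Matrix (Fin 2) (Fin 2) ℂ) * (k : Matrix (Fin 2) (Fin 2) ℂ)) = _
    rw [star_mul, Matrix.mul_assoc, ← Matrix.mul_assoc (k : Matrix (Fin 2) (Fin 2) ℂ), hk, Matrix.one_mul]
  rw [e1]

/-- `ρ(1, h) = √2 · arccos(Re tr h / 2)` — the distance from the identity is `√2` times the co-latitude of the unit quaternion `h`.
[cite: GallotHulinLafontaine2004, 2.90] -/
theorem riemannDist_two_one_left (h : Matrix.specialUnitaryGroup (Fin 2) ℂ) :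
    (fundamentalLatticeRep 2).riemannDist 1 h = Real.sqrt 2 * Real.arccos ((h : Matrix (Fin 2) (Fin 2) ℂ).trace.re / 2) := by
  rw [riemannDist_two_eq]
  have e1 : (h : Matrix (Fin 2) (Fin 2) ℂ) * star ((1 : Matrix.specialUnitaryGroup (Fin 2) ℂ) : Matrix (Fin 2) (Fin 2) ℂ) = (h : Matrix (Fin 2) (Fin 2) ℂ) := by
    change (h : Matrix (Fin 2) (Fin 2) ℂ) * star (1 : Matrix (Fin 2) (Fin 2) ℂ) = _
    rw [star_one, Matrix.mul_one]
  rw [e1]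

/-- ★ **Diameter**: `ρ(g,h) ≤ √2 · π` (attained at `h = −g`). [cite: GallotHulinLafontaine2004, 2.90] -/
theorem riemannDist_two_le (g h : Matrix.specialUnitaryGroup (Fin 2) ℂ) :
    (fundamentalLatticeRep 2).riemannDist g h ≤ Real.sqrt 2 * Real.pi := by
  rw [riemannDist_two_eq]
  exact mul_le_mul_of_nonneg_left (Real.arccos_le_pi _) (Real.sqrt_nonneg 2)

/-- ★ **Non-degeneracy**: `ρ(g,h) = 0 ↔ g = h` on `SU(2)`. [cite: GallotHulinLafontaine2004, 2.91] -/
theorem riemannDist_two_eq_zero_iff (g h : Matrix.specialUnitaryGroup (Fin 2) ℂ) :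
    (fundamentalLatticeRep 2).riemannDist g h = 0 ↔ g = h := by
  refine ⟨fun h0 => ?_, fun h0 => by rw [h0]; exact (fundamentalLatticeRep 2).riemannDist_self h⟩
  rw [riemannDist_two_eq, mul_eq_zero] at h0
  rcases h0 with h0 | h0
  · exact absurd h0 (Real.sqrt_ne_zero'.2 (by norm_num))
  · have h1 := Real.arccos_eq_zero.1 h0
    have hK' : ((h * g⁻¹ : Matrix.specialUnitaryGroup (Fin 2) ℂ) : Matrix (Fin 2) (Fin 2) ℂ) =
        (h : Matrix (Fin 2) (Fin 2) ℂ) * star (g : Matrix (Fin 2) (Fin 2) ℂ) := rfl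
    obtain ⟨-, h2⟩ := neg_one_le_half_re_trace_two (h * g⁻¹)
    rw [hK'] at h2
    have hK : ((h * g⁻¹ : Matrix.specialUnitaryGroup (Fin 2) ℂ) : Matrix (Fin 2) (Fin 2) ℂ) = 1 :=
      coe_eq_one_of_re_trace_eq_two (h * g⁻¹) (by rw [hK']; linarith)
    have hk1 : h * g⁻¹ = 1 := Subtype.ext hK
    rw [mul_inv_eq_one] at hk1
    exact hk1.symm

/-! ## §2. Chord versus arc -/

/-- `‖h − g‖_F² = 4 − 2 Re tr(h gᴴ)` for `g, h ∈ SU(2)` (`‖g‖² = ‖h‖² = 2`). [folklore] -/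
theorem hsForm_sub_self_two (g h : Matrix.specialUnitaryGroup (Fin 2) ℂ) :
    hsForm 2 ((h : Matrix (Fin 2) (Fin 2) ℂ) - (g : Matrix (Fin 2) (Fin 2) ℂ)) ((h : Matrix (Fin 2) (Fin 2) ℂ) - (g : Matrix (Fin 2) (Fin 2) ℂ)) =
      4 - 2 * (((h : Matrix (Fin 2) (Fin 2) ℂ) * star (g : Matrix (Fin 2) (Fin 2) ℂ)).trace.re) := by
  have hhh : hsForm 2 (h : Matrix (Fin 2) (Fin 2) ℂ) (h : Matrix (Fin 2) (Fin 2) ℂ) = 2 := hsForm_self_fundamentalRep h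
  have hgg : hsForm 2 (g : Matrix (Fin 2) (Fin 2) ℂ) (g : Matrix (Fin 2) (Fin 2) ℂ) = 2 := hsForm_self_fundamentalRep g
  have hhg : hsForm 2 (h : Matrix (Fin 2) (Fin 2) ℂ) (g : Matrix (Fin 2) (Fin 2) ℂ) =
      (((h : Matrix (Fin 2) (Fin 2) ℂ) * star (g : Matrix (Fin 2) (Fin 2) ℂ)).trace.re) := by
    rw [hsForm_apply, Matrix.star_eq_conjTranspose]
  have hgh : hsForm 2 (g : Matrix (Fin 2) (Fin 2) ℂ) (h : Matrix (Fin 2) (Fin 2) ℂ) =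
      (((h : Matrix (Fin 2) (Fin 2) ℂ) * star (g : Matrix (Fin 2) (Fin 2) ℂ)).trace.re) := by rw [hsForm_comm, hhg]
  simp only [map_sub, LinearMap.sub_apply, hhh, hgg, hhg, hgh]
  ring

/-- `‖h − g‖_F² = 4(1 − cos(ρ(g,h)/√2))`: the chord as a function of the arc. [cite: GallotHulinLafontaine2004, 2.90] -/
theorem hsForm_sub_self_two_eq_cos (g h : Matrix.specialUnitaryGroup (Fin 2) ℂ) :
    hsForm 2 ((h : Matrix (Fin 2) (Fin 2) ℂ) - (g : Matrix (Fin 2) (Fin 2) ℂ)) ((h : Matrix (Fin 2) (Fin 2) ℂ) - (g : Matrix (Fin 2) (Fin 2) ℂ)) =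
      4 * (1 - Real.cos ((fundamentalLatticeRep 2).riemannDist g h / Real.sqrt 2)) := by
  have hK' : ((h * g⁻¹ : Matrix.specialUnitaryGroup (Fin 2) ℂ) : Matrix (Fin 2) (Fin 2) ℂ) =
      (h : Matrix (Fin 2) (Fin 2) ℂ) * star (g : Matrix (Fin 2) (Fin 2) ℂ) := rfl
  obtain ⟨h1, h2⟩ := neg_one_le_half_re_trace_two (h * g⁻¹)
  rw [hK'] at h1 h2
  rw [hsForm_sub_self_two, riemannDist_two_eq, mul_div_cancel_left₀ _ (Real.sqrt_ne_zero'.2 (by norm_num : (0:ℝ) < 2)),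
    Real.cos_arccos h1 h2]
  ring

/-- ★★ **Chord ≤ arc**: `‖h − g‖_F ≤ ρ(g,h)` (`4(1 − cos θ) ≤ 2θ²`). [cite: GallotHulinLafontaine2004, 2.91] -/
theorem sqrt_hsForm_sub_le_riemannDist_two (g h : Matrix.specialUnitaryGroup (Fin 2) ℂ) :
    Real.sqrt (hsForm 2 ((h : Matrix (Fin 2) (Fin 2) ℂ) - (g : Matrix (Fin 2) (Fin 2) ℂ)) ((h : Matrix (Fin 2) (Fin 2) ℂ) - (g : Matrix (Fin 2) (Fin 2) ℂ))) ≤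
      (fundamentalLatticeRep 2).riemannDist g h := by
  have hρ0 : 0 ≤ (fundamentalLatticeRep 2).riemannDist g h := (fundamentalLatticeRep 2).riemannDist_nonneg g h
  rw [hsForm_sub_self_two_eq_cos]
  set θ : ℝ := (fundamentalLatticeRep 2).riemannDist g h / Real.sqrt 2 with hθ
  have hρ : (fundamentalLatticeRep 2).riemannDist g h = Real.sqrt 2 * θ := by
    rw [hθ, mul_div_cancel₀ _ (Real.sqrt_ne_zero'.2 (by norm_num : (0:ℝ) < 2))]
  have hcos := Real.one_sub_sq_div_two_le_cos (x := θ)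
  have hsq : (Real.sqrt 2 * θ) ^ 2 = 2 * θ ^ 2 := by rw [mul_pow, Real.sq_sqrt (by norm_num : (0:ℝ) ≤ 2)]
  rw [hρ] at hρ0 ⊢
  calc Real.sqrt (4 * (1 - Real.cos θ)) ≤ Real.sqrt ((Real.sqrt 2 * θ) ^ 2) := Real.sqrt_le_sqrt (by rw [hsq]; linarith)
    _ = Real.sqrt 2 * θ := Real.sqrt_sq hρ0

/-- `1 − cos θ = 2 sin²(θ/2) ≥ 2θ²/π²` for `0 ≤ θ ≤ π` (Jordan's inequality at `θ/2`). [folklore] -/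
theorem two_mul_sq_le_pi_sq_mul_one_sub_cos {θ : ℝ} (h0 : 0 ≤ θ) (hπ : θ ≤ Real.pi) :
    2 * θ ^ 2 ≤ Real.pi ^ 2 * (1 - Real.cos θ) := by
  have hs : Real.sin (θ / 2) ^ 2 = 1 / 2 - Real.cos θ / 2 := by
    have := Real.sin_sq_eq_half_sub (θ / 2)
    rwa [show 2 * (θ / 2) = θ by ring] at this
  have hj : 2 / Real.pi * (θ / 2) ≤ Real.sin (θ / 2) := Real.mul_le_sin (by linarith) (by linarith)
  have hj0 : 0 ≤ 2 / Real.pi * (θ / 2) := by positivity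
  have hj2 : (2 / Real.pi * (θ / 2)) ^ 2 ≤ Real.sin (θ / 2) ^ 2 := pow_le_pow_left₀ hj0 hj 2
  have hpi : 0 < Real.pi := Real.pi_pos
  have e : (2 / Real.pi * (θ / 2)) ^ 2 = θ ^ 2 / Real.pi ^ 2 := by field_simp
  rw [e, hs, div_le_iff₀ (by positivity)] at hj2
  nlinarith

/-- ★★ **Arc ≤ (π/2)·chord**: `ρ(g,h) ≤ (π/2)·‖h − g‖_F` (equality at antipodes `h = −g`: `ρ = √2π`, chord `2√2`). [cite: GallotHulinLafontaine2004, 2.91] -/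
theorem riemannDist_two_le_pi_div_two_mul_sqrt_hsForm_sub (g h : Matrix.specialUnitaryGroup (Fin 2) ℂ) :
    (fundamentalLatticeRep 2).riemannDist g h ≤ Real.pi / 2 *
      Real.sqrt (hsForm 2 ((h : Matrix (Fin 2) (Fin 2) ℂ) - (g : Matrix (Fin 2) (Fin 2) ℂ)) ((h : Matrix (Fin 2) (Fin 2) ℂ) - (g : Matrix (Fin 2) (Fin 2) ℂ))) := by
  have hρ0 : 0 ≤ (fundamentalLatticeRep 2).riemannDist g h := (fundamentalLatticeRep 2).riemannDist_nonneg g h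
  have hρπ : (fundamentalLatticeRep 2).riemannDist g h ≤ Real.sqrt 2 * Real.pi := riemannDist_two_le g h
  rw [hsForm_sub_self_two_eq_cos]
  set θ : ℝ := (fundamentalLatticeRep 2).riemannDist g h / Real.sqrt 2 with hθ
  have h2 : (0 : ℝ) < Real.sqrt 2 := Real.sqrt_pos.2 (by norm_num)
  have hρ : (fundamentalLatticeRep 2).riemannDist g h = Real.sqrt 2 * θ := by
    rw [hθ, mul_div_cancel₀ _ h2.ne']
  rw [hρ] at hρ0 hρπ ⊢
  have hθ0 : 0 ≤ θ := by
    rcases (mul_nonneg_iff_of_pos_left h2).1 hρ0 with h; exact h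
  have hθπ : θ ≤ Real.pi := le_of_mul_le_mul_left hρπ h2
  have key := two_mul_sq_le_pi_sq_mul_one_sub_cos hθ0 hθπ
  have hR : 0 ≤ Real.pi / 2 * Real.sqrt (4 * (1 - Real.cos θ)) := by positivity
  refine (pow_le_pow_iff_left₀ hρ0 hR two_ne_zero).1 ?_
  rw [mul_pow, Real.sq_sqrt (by norm_num : (0:ℝ) ≤ 2), mul_pow, Real.sq_sqrt (by nlinarith [Real.cos_le_one θ])]
  nlinarith

/-- The Literature's Frobenius norm is the square root of the Hilbert–Schmidt form: `‖X‖_F = √⟨X,X⟩`. [folklore] -/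
theorem frobNorm_eq_sqrt_hsForm {N : ℕ} (X : Matrix (Fin N) (Fin N) ℂ) : frobNorm X = Real.sqrt (hsForm N X X) := by
  rw [frobNorm, hsForm_self]

/-- ★★ `‖h − g‖_F ≤ ρ(g,h)` in the Literature's `frobNorm`. [cite: GallotHulinLafontaine2004, 2.91] -/
theorem frobNorm_sub_le_riemannDist_two (g h : Matrix.specialUnitaryGroup (Fin 2) ℂ) :
    frobNorm ((h : Matrix (Fin 2) (Fin 2) ℂ) - (g : Matrix (Fin 2) (Fin 2) ℂ)) ≤ (fundamentalLatticeRep 2).riemannDist g h := by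
  rw [frobNorm_eq_sqrt_hsForm]
  exact sqrt_hsForm_sub_le_riemannDist_two g h

/-- ★★ `ρ(g,h) ≤ (π/2)·‖h − g‖_F` in the Literature's `frobNorm`. [cite: GallotHulinLafontaine2004, 2.91] -/
theorem riemannDist_two_le_pi_div_two_mul_frobNorm_sub (g h : Matrix.specialUnitaryGroup (Fin 2) ℂ) :
    (fundamentalLatticeRep 2).riemannDist g h ≤ Real.pi / 2 * frobNorm ((h : Matrix (Fin 2) (Fin 2) ℂ) - (g : Matrix (Fin 2) (Fin 2) ℂ)) := by
  rw [frobNorm_eq_sqrt_hsForm]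
  exact riemannDist_two_le_pi_div_two_mul_sqrt_hsForm_sub g h

/-! ## §3. The torus cost `ρ_L² = Σ_e ρ(U_e, U'_e)²` of Shen–Zhu–Zhu's (4.5) versus the summed squared chords -/

/-- ★★ **`Σ_e ‖U'_e − U_e‖_F² ≤ ρ_L(U,U')²`** on every torus `(ℤ/L)^d`, `SU(2)` links. [cite: ShenZhuZhu2022, Theorem 4.2 (4.5)] -/
theorem sum_hsForm_sub_le_torusRiemannDistSq_two {d L : ℕ} [NeZero L] (U U' : GaugeConfig d L (Matrix.specialUnitaryGroup (Fin 2) ℂ)) :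
    ∑ e : Edge d L, hsForm 2 ((U' e : Matrix (Fin 2) (Fin 2) ℂ) - (U e : Matrix (Fin 2) (Fin 2) ℂ))
        ((U' e : Matrix (Fin 2) (Fin 2) ℂ) - (U e : Matrix (Fin 2) (Fin 2) ℂ)) ≤
      torusRiemannDistSq (fundamentalLatticeRep 2) U U' := by
  unfold torusRiemannDistSq
  refine Finset.sum_le_sum fun e _ => ?_
  have h0 := hsForm_self_nonneg (N := 2) ((U' e : Matrix (Fin 2) (Fin 2) ℂ) - (U e : Matrix (Fin 2) (Fin 2) ℂ))
  have h := sqrt_hsForm_sub_le_riemannDist_two (U e) (U' e)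
  calc hsForm 2 ((U' e : Matrix (Fin 2) (Fin 2) ℂ) - (U e : Matrix (Fin 2) (Fin 2) ℂ)) ((U' e : Matrix (Fin 2) (Fin 2) ℂ) - (U e : Matrix (Fin 2) (Fin 2) ℂ))
      = Real.sqrt (hsForm 2 ((U' e : Matrix (Fin 2) (Fin 2) ℂ) - (U e : Matrix (Fin 2) (Fin 2) ℂ))
          ((U' e : Matrix (Fin 2) (Fin 2) ℂ) - (U e : Matrix (Fin 2) (Fin 2) ℂ))) ^ 2 := (Real.sq_sqrt h0).symm
    _ ≤ (fundamentalLatticeRep 2).riemannDist (U e) (U' e) ^ 2 := pow_le_pow_left₀ (Real.sqrt_nonneg _) h 2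

/-- ★★ **`ρ_L(U,U')² ≤ (π²/4)·Σ_e ‖U'_e − U_e‖_F²`** on every torus `(ℤ/L)^d`, `SU(2)` links: the cost of Shen–Zhu–Zhu's (4.5) is dominated by the
summed squared Frobenius distances with the universal factor `π²/4`. [cite: ShenZhuZhu2022, Theorem 4.2 (4.5)] -/
theorem torusRiemannDistSq_two_le {d L : ℕ} [NeZero L] (U U' : GaugeConfig d L (Matrix.specialUnitaryGroup (Fin 2) ℂ)) :
    torusRiemannDistSq (fundamentalLatticeRep 2) U U' ≤ Real.pi ^ 2 / 4 *
      ∑ e : Edge d L, hsForm 2 ((U' e : Matrix (Fin 2) (Fin 2) ℂ) - (U e : Matrix (Fin 2) (Fin 2) ℂ))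
        ((U' e : Matrix (Fin 2) (Fin 2) ℂ) - (U e : Matrix (Fin 2) (Fin 2) ℂ)) := by
  unfold torusRiemannDistSq
  rw [Finset.mul_sum]
  refine Finset.sum_le_sum fun e _ => ?_
  have h0 := hsForm_self_nonneg (N := 2) ((U' e : Matrix (Fin 2) (Fin 2) ℂ) - (U e : Matrix (Fin 2) (Fin 2) ℂ))
  have hρ0 := (fundamentalLatticeRep 2).riemannDist_nonneg (U e) (U' e)
  have h := riemannDist_two_le_pi_div_two_mul_sqrt_hsForm_sub (U e) (U' e)
  calc (fundamentalLatticeRep 2).riemannDist (U e) (U' e) ^ 2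
      ≤ (Real.pi / 2 * Real.sqrt (hsForm 2 ((U' e : Matrix (Fin 2) (Fin 2) ℂ) - (U e : Matrix (Fin 2) (Fin 2) ℂ))
          ((U' e : Matrix (Fin 2) (Fin 2) ℂ) - (U e : Matrix (Fin 2) (Fin 2) ℂ)))) ^ 2 := pow_le_pow_left₀ hρ0 h 2
    _ = Real.pi ^ 2 / 4 * hsForm 2 ((U' e : Matrix (Fin 2) (Fin 2) ℂ) - (U e : Matrix (Fin 2) (Fin 2) ℂ))
          ((U' e : Matrix (Fin 2) (Fin 2) ℂ) - (U e : Matrix (Fin 2) (Fin 2) ℂ)) := by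
        rw [mul_pow, Real.sq_sqrt h0]; ring

/-- ★ **`ρ_L(U,U')² ≤ 2π²·#E`**: the cost of (4.5) is bounded by the diameter, `#E = |Edge d L|` links. [cite: ShenZhuZhu2022, Theorem 4.2 (4.5)] -/
theorem torusRiemannDistSq_two_le_card {d L : ℕ} [NeZero L] (U U' : GaugeConfig d L (Matrix.specialUnitaryGroup (Fin 2) ℂ)) :
    torusRiemannDistSq (fundamentalLatticeRep 2) U U' ≤ 2 * Real.pi ^ 2 * Fintype.card (Edge d L) := by
  unfold torusRiemannDistSq
  have h : ∀ e : Edge d L, (fundamentalLatticeRep 2).riemannDist (U e) (U' e) ^ 2 ≤ 2 * Real.pi ^ 2 := fun e => by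
    have h1 := riemannDist_two_le (U e) (U' e)
    have h0 := (fundamentalLatticeRep 2).riemannDist_nonneg (U e) (U' e)
    calc (fundamentalLatticeRep 2).riemannDist (U e) (U' e) ^ 2 ≤ (Real.sqrt 2 * Real.pi) ^ 2 := pow_le_pow_left₀ h0 h1 2
      _ = 2 * Real.pi ^ 2 := by rw [mul_pow, Real.sq_sqrt (by norm_num : (0:ℝ) ≤ 2)]
  calc ∑ e : Edge d L, (fundamentalLatticeRep 2).riemannDist (U e) (U' e) ^ 2 ≤ ∑ _e : Edge d L, 2 * Real.pi ^ 2 := Finset.sum_le_sum fun e _ => h e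
    _ = 2 * Real.pi ^ 2 * Fintype.card (Edge d L) := by rw [Finset.sum_const, Finset.card_univ, nsmul_eq_mul]; ring

end Summit.QuantumFields.YangMills.Theorems.ColdStartUniversality

end
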